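import Summits.ABC.IUTFork.Joshi.ATS4MainTheorem
import HarnessLib

/-!
# D-0123(C) IUT REPAIR-CATALOGUE (rung LADDER-ABC:A2), row RC-208 (block-E E-8): [J-IV] Thm 2.10.1 (3) «Effective form of
# Mordell's Conjecture is true for X/L» — the two shapes that ARE typable today over the tree's reading carrier
# `Joshi.ATS4.CurveHeightDatum` (memo plan/E/t40/NOT-TYPABLE-Thm2101-3.md §4, shapes (R1)/(R2)), kernel-checked, 0 facts

Record file (D-0012) of the abc-iut cell; SUPPORT / pre-work typed by the floating NEW-row tester abc-iut-rcat-tst-8 (gen 3) for the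
catalogue's one open M-row cell (RC-208 kernel, «UNTESTED (untypable)»). The WORD for the cell stays with the cataloguer abc-iut-rcat-cat-1
and the referee abc-iut-rcat-ref-1 (minted only on a KEY); this file changes no count by itself. TAKES NO SIDE on [IUTchIII] Cor. 3.12 /
[IUTchIV] Thm. 1.10, on K. Joshi's claims or on any author (D-0045); nothing here asserts abc proved or refuted; typed ≠ proved;
located ≠ adjudicated. Source: K. Joshi, *Arithmetic Teichmüller Spaces IV* (arXiv:2403.10430v2, unrefereed, claim status disputed;
bib `Joshi2024ATS4`; render `HOME/lit/renders/Joshi-arxiv-2403.10430/p0034.txt`): Thm 2.10.1 body l.13–17 (Vojta's Height Inequality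
`ht_{ω_X(D)} ≲ (1+ε)(log-diff_X + log-con_D)` on `U(Q̄)_{≤d}`), l.18–21 «As a consequence the following assertions are also true: …
(3) Effective form of Mordell's Conjecture is true for X/L.», Rmk 2.10.2 l.22–23 «The assertion that the effective abc-conjecture implies
the effective Mordell's conjecture is established in [Elkies, 1991]».

## WHY (3) IS NOT TYPABLE AS PRINTED (memo §3, carried): (N1) «effectively computable bound» has no `Prop` in Lean/Mathlib for a
real-valued function of a CURVE (every effective statement in the tree is stated with an explicit TERM instead); (N2) the height
`ht_{ω_X}` on `X(L)` for a genus-≥ 2 curve (the height machine: a Weil height attached to a divisor class, defined only UP TO O(1)) is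
absent — the carrier `CurveHeightDatum` holds `ht` as an abstract field. The INEFFECTIVE Mordell conjecture (Faltings) IS typed in the
tree on the genuine function-field carrier: `Literature.Abc.finite_ratPlaces_of_two_le_genus` (not used here).

## WHAT THIS FILE TYPES AND PROVES (all over the EXISTING carrier; no new definition item; standard axioms)
* §1 `ratPoints 𝔛` = the degree-1 (`L`-rational) points of `U`; (R1) `RatPointsHtBounded 𝔛` := «`ht` is bounded above on the
  `L`-points» = (3) MINUS effectivity (Mordell-shape modulo a Northcott property of `ht`, which is one more reading hypothesis);
  (R2) `RatPointsHtLe 𝔛 B` := the same with a GIVEN bound `B` (the only formal sense of «effective» available: an explicit term);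
  `VojtaExplicit 𝔛 d ε C` := the displayed inequality with its O(1) constant `C` EXPOSED; `vojtaInequality_iff_exists_vojtaExplicit`:
  the tree's typed display (`CurveHeightDatum.VojtaInequality`, hence `ATS4.MainTheorem`) is LITERALLY the `∃ C`-closure of the explicit form.
* §2 (R2) chain `ratPointsHtLe_of_vojtaExplicit`: explicit Vojta at `d = 1` + an explicit bound `D` for `log-diff + log-con` on the
  `L`-points ⟹ the explicit height bound `(1+ε)·D + C` — the kernel form of Rmk 2.10.2's route «EFFECTIVE abc/Vojta ⟹ effective Mordell»:
  the effectivity of the conclusion is exactly the effectivity of the INPUT constant `C`, which the typed Thm 2.10.1 does not carry.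
* §3 (R1) `ratPointsHtBounded_of_vojtaHeightInequality` / `_of_mainTheorem`: the typed (∃-constant) Thm 2.10.1 ⟹ the ineffective shadow,
  given `log-diff + log-con ≲ 0` on the `L`-points — automatic in the Mordell reading `D = ∅` (`log-con_∅ = 0`, `log-diff` constant
  `= log|D_L|/[L:ℚ]` on `X(L)`): `bdLe_logDiff_logCon_of_const`.
* §4 (N2 in kernel form) `shiftHt 𝔛 f` = the same datum with `ht` replaced by `ht + f`: for BOUNDED `f` (the O(1)-ambiguity of a Weil
  height) the typed Thm 2.10.1 and the ineffective shadow are INVARIANT (`vojtaHeightInequality_shiftHt_iff`,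
  `ratPointsHtBounded_shiftHt_iff`) while every explicit bound `B` is BROKEN by a constant shift at any `L`-point
  (`not_ratPointsHtLe_shiftHt_const`, packaged `explicitBound_not_invariant_under_bounded_shift`) ⇒ an effective (3) needs a NORMALISED
  height the carrier does not fix — which is (N2).
* §5 (non-vacuity, appended) at the tree's one GENUINE instance, the tripod `(ℙ¹_ℚ, {0,1,∞})`: `ht(λ = n) = log n`
  (`tripod_ht_ratPoint_natCast`), so (R1) is FALSE there (`not_ratPointsHtBounded_tripod`, unconditional) and §3's `D = ∅` side hypothesis
  is load-bearing (`not_bdLe_logDiff_logCon_tripod_of_vojta`).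
Nothing here bears on the Cor 3.12 kernel: (3) is DOWNSTREAM (consumes Vojta/abc); the row's other battery columns are n/a as catalogued.
-/

noncomputable section

open Literature.NumberTheory.DiophantineGeometry.GenEll
open Summit.ABC.IUTFork.Joshi.ATS4

namespace Summit.ABC.IUTFork.Repair.RcatJoshiEffMordell

universe u v

variable (𝔛 : CurveHeightDatum.{u})

/-! ## §1 The typable shapes (R1)/(R2) and the explicit form of the display -/

/-- The `L`-RATIONAL points of `U = X − D`: points of `U(Q̄)` of degree `[L(P):L] = 1` (for `D = ∅` this reads `X(L)`, the set
Mordell's conjecture is about). [cite: Joshi2024ATS4, §2.4–2.5 p.31 l.23–24, p.32 l.5–6] -/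
def ratPoints : Set 𝔛.Pt := {P | P ∈ 𝔛.U ∧ 𝔛.deg P = 1}

/-- `L`-rational points have degree `≤ 1`: `ratPoints ⊆ U(Q̄)_{≤1}`. [folklore] -/
theorem ratPoints_subset_pointsLe_one : ratPoints 𝔛 ⊆ 𝔛.pointsLe 1 :=
  fun _ hP => ⟨hP.1, hP.2.le⟩

/-- **(R1) the INEFFECTIVE SHADOW of Thm 2.10.1 (3)** on the reading carrier: «the height `ht_{ω_X(D)}` is bounded above on the
`L`-rational points of `U`» — (3) with «effective» DELETED (Mordell-shape: with a Northcott property of `ht` on `X(L)` it gives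
finiteness; Northcott is not part of the carrier). A typed READING, claim-tagged because print asserts (3) as a consequence of its
Thm 2.10.1; never asserted here. [claim: Joshi2024ATS4, status: disputed] [cite: Joshi2024ATS4, Thm 2.10.1 (3) p.34 l.21] -/
@[claim "Joshi2024ATS4" "disputed"]
def RatPointsHtBounded : Prop := ∃ B : ℝ, ∀ P ∈ ratPoints 𝔛, 𝔛.ht P ≤ B

/-- **(R2) the EXPLICIT-BOUND form** — «effective» in the only formal sense available (an explicit TERM `B`): every `L`-rational
point of `U` has height `≤ B`. For print's (3) the bound `B = B(X, L)` would have to be an effectively computable function of the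
curve — notion (N1), absent; here `B` is just a given real. [claim: Joshi2024ATS4, status: disputed]
[cite: Joshi2024ATS4, Thm 2.10.1 (3) p.34 l.21] -/
@[claim "Joshi2024ATS4" "disputed"]
def RatPointsHtLe (B : ℝ) : Prop := ∀ P ∈ ratPoints 𝔛, 𝔛.ht P ≤ B

/-- The displayed inequality of Thm 2.10.1 at degree `d` and `ε` WITH ITS O(1) CONSTANT `C` EXPOSED:
`ht(P) − (1+ε)(log-diff(P) + log-con(P)) ≤ C` on `U(Q̄)_{≤d}` (the body of `GenEll.BDLe` with `C` free).
A typed READING of print's display (constant named); never asserted. [claim: Joshi2024ATS4, status: disputed]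
[cite: Joshi2024ATS4, Thm 2.10.1 p.34 l.13–17; Conj 2.5.1 p.32 l.13–14] -/
@[claim "Joshi2024ATS4" "disputed"]
def VojtaExplicit (d : ℕ) (ε C : ℝ) : Prop :=
  ∀ P ∈ 𝔛.pointsLe d, 𝔛.ht P - (1 + ε) * (𝔛.logDiff P + 𝔛.logCon P) ≤ C

/-- The tree's typed display `CurveHeightDatum.VojtaInequality d ε` (`≲` = `GenEll.BDLe`, an `∃ C`) is LITERALLY the `∃ C`-closure
of the explicit form: the constant is existential, i.e. the typed Thm 2.10.1 is ineffective by construction (definitional unfolding).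
[cite: Joshi2024ATS4, Conj 2.5.1 p.32 l.13–14] -/
theorem vojtaInequality_iff_exists_vojtaExplicit (d : ℕ) (ε : ℝ) :
    𝔛.VojtaInequality d ε ↔ ∃ C : ℝ, VojtaExplicit 𝔛 d ε C := Iff.rfl

/-- (R1) is the `∃ B`-closure of (R2) (definitional). [folklore] -/
theorem ratPointsHtBounded_iff_exists_ratPointsHtLe : RatPointsHtBounded 𝔛 ↔ ∃ B : ℝ, RatPointsHtLe 𝔛 B := Iff.rfl

/-! ## §2 (R2): the explicit chain — effectivity of the conclusion = effectivity of the input constant -/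

/-- **Explicit Vojta ⟹ explicit height bound on the `L`-points** (kernel form of the route of Rmk 2.10.2, «effective abc ⟹ effective
Mordell» [Elkies 1991]): if the display holds at `d = 1` with an EXPLICIT constant `C`, and `log-diff + log-con ≤ D` explicitly on the
`L`-rational points, then every `L`-rational point has height `≤ (1+ε)·D + C`. The bound is a term in `C`, `D`, `ε`: it is as
«effective» as `C` is — and the typed Thm 2.10.1 supplies `C` only existentially. [cite: Joshi2024ATS4, Rmk 2.10.2 p.34 l.22–23] -/
theorem ratPointsHtLe_of_vojtaExplicit {ε C D : ℝ} (hε : 0 ≤ 1 + ε) (hV : VojtaExplicit 𝔛 1 ε C)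
    (hD : ∀ P ∈ ratPoints 𝔛, 𝔛.logDiff P + 𝔛.logCon P ≤ D) : RatPointsHtLe 𝔛 ((1 + ε) * D + C) := by
  intro P hP
  have h1 := hV P (ratPoints_subset_pointsLe_one 𝔛 hP)
  have h2 := mul_le_mul_of_nonneg_left (hD P hP) hε
  linarith

/-! ## §3 (R1): the ineffective shadow follows from the typed (∃-constant) Thm 2.10.1 -/

/-- **Typed Vojta (Conj 2.5.1 / Thm 2.10.1 for `𝔛`) ⟹ (R1)**, given that `log-diff + log-con` is bounded above on the `L`-rational
points (`≲ 0` in [GenEll] notation): unfold the two `∃`-constants at `d = 1`, `ε = 1` and add them (memo §4 (R1) proof sketch).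
An implication between typed statements; nothing asserted. [cite: Joshi2024ATS4, Thm 2.10.1 (3) p.34 l.18–21] -/
theorem ratPointsHtBounded_of_vojtaHeightInequality (h : 𝔛.VojtaHeightInequality)
    (hD : BDLe (ratPoints 𝔛) (fun P => 𝔛.logDiff P + 𝔛.logCon P) 0) : RatPointsHtBounded 𝔛 := by
  obtain ⟨C, hC⟩ := h 1 one_pos 1 one_pos
  obtain ⟨D, hD⟩ := hD
  refine ⟨(1 + 1) * D + C, ratPointsHtLe_of_vojtaExplicit 𝔛 (by norm_num) hC fun P hP => ?_⟩
  have h' := hD P hP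
  simp only [Pi.zero_apply, sub_zero] at h'
  exact h'

/-- **In the Mordell reading `D = ∅`** (so `U = X`, `log-con_∅ = 0`, and `log-diff_X(P) = log|D_L|/[L:ℚ]` is CONSTANT on `X(L)`,
§2.4 p.31 l.25–31) the side hypothesis of `ratPointsHtBounded_of_vojtaHeightInequality` holds: a constant `log-diff` and a vanishing
`log-con` on the `L`-points give `log-diff + log-con ≲ 0` there. [cite: Joshi2024ATS4, §2.4 p.31 l.25–39] -/
theorem bdLe_logDiff_logCon_of_const {c : ℝ} (hdiff : ∀ P ∈ ratPoints 𝔛, 𝔛.logDiff P = c)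
    (hcon : ∀ P ∈ ratPoints 𝔛, 𝔛.logCon P = 0) : BDLe (ratPoints 𝔛) (fun P => 𝔛.logDiff P + 𝔛.logCon P) 0 :=
  ⟨c, fun P hP => by simp [hdiff P hP, hcon P hP]⟩

/-- **Typed Main Theorem 2.10.1 (family form `ATS4.MainTheorem 𝔛`) ⟹ (R1) for every member in the Mordell reading** (`log-diff`
constant and `log-con = 0` on its `L`-points): the ineffective shadow of consequence (3), PROVED as an implication from the named
CLAIM (which stays a hypothesis). The effective (3) itself does not follow from `MainTheorem` as typed (§2: its constant is `∃`-bound;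
§4: it is even invariant under the O(1)-ambiguity of `ht`). [cite: Joshi2024ATS4, Thm 2.10.1 (3) p.34 l.18–21] -/
theorem ratPointsHtBounded_of_mainTheorem {ι : Type v} (𝔛 : ι → CurveHeightDatum.{u}) (h : MainTheorem 𝔛) (i : ι) {c : ℝ}
    (hdiff : ∀ P ∈ ratPoints (𝔛 i), (𝔛 i).logDiff P = c) (hcon : ∀ P ∈ ratPoints (𝔛 i), (𝔛 i).logCon P = 0) :
    RatPointsHtBounded (𝔛 i) :=
  ratPointsHtBounded_of_vojtaHeightInequality (𝔛 i) (h i) (bdLe_logDiff_logCon_of_const (𝔛 i) hdiff hcon)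

/-! ## §4 (N2) in kernel form: the O(1)-ambiguity of the height — ∃-forms invariant, explicit bounds not -/

/-- The same curve datum with its height replaced by `ht + f` (a Weil height attached to a divisor class is defined only up to a
bounded function: the «height machine» ambiguity behind (N2)). Points, degrees, `U`, `log-diff`, `log-con` unchanged. [folklore] -/
def shiftHt (f : 𝔛.Pt → ℝ) : CurveHeightDatum.{u} :=
  { 𝔛 with ht := fun P => 𝔛.ht P + f P }

/-- `shiftHt` does not move `U(Q̄)_{≤d}`. [folklore] -/
@[simp] theorem pointsLe_shiftHt (f : 𝔛.Pt → ℝ) (d : ℕ) : (shiftHt 𝔛 f).pointsLe d = 𝔛.pointsLe d := rfl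

/-- `shiftHt` does not move the `L`-rational points. [folklore] -/
@[simp] theorem ratPoints_shiftHt (f : 𝔛.Pt → ℝ) : ratPoints (shiftHt 𝔛 f) = ratPoints 𝔛 := rfl

/-- The shifted height. [folklore] -/
@[simp] theorem shiftHt_ht (f : 𝔛.Pt → ℝ) (P : 𝔛.Pt) : (shiftHt 𝔛 f).ht P = 𝔛.ht P + f P := rfl

/-- `shiftHt` does not move `log-diff`. [folklore] -/
@[simp] theorem shiftHt_logDiff (f : 𝔛.Pt → ℝ) : (shiftHt 𝔛 f).logDiff = 𝔛.logDiff := rfl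

/-- `shiftHt` does not move `log-con`. [folklore] -/
@[simp] theorem shiftHt_logCon (f : 𝔛.Pt → ℝ) : (shiftHt 𝔛 f).logCon = 𝔛.logCon := rfl

/-- **The typed display is invariant under bounded shifts of the height** (`|f| ≤ M`): `≲` absorbs O(1). [folklore]
[cite: MochizukiGenEll2010, Def 1.2 (ii) p.5] -/
theorem vojtaInequality_shiftHt_iff {f : 𝔛.Pt → ℝ} {M : ℝ} (hf : ∀ P, |f P| ≤ M) (d : ℕ) (ε : ℝ) :
    (shiftHt 𝔛 f).VojtaInequality d ε ↔ 𝔛.VojtaInequality d ε := by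
  simp only [vojtaInequality_iff_exists_vojtaExplicit, VojtaExplicit, pointsLe_shiftHt, shiftHt_ht, shiftHt_logDiff,
    shiftHt_logCon]
  constructor
  · rintro ⟨C, hC⟩
    refine ⟨C + M, fun P hP => ?_⟩
    have h1 := hC P hP
    have h2 := (abs_le.mp (hf P)).1
    linarith
  · rintro ⟨C, hC⟩
    refine ⟨C + M, fun P hP => ?_⟩
    have h1 := hC P hP
    have h2 := (abs_le.mp (hf P)).2
    linarith

/-- **Typed Thm 2.10.1 / Conj 2.5.1 for `𝔛` is invariant under bounded shifts of `ht`.** [folklore]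
[cite: Joshi2024ATS4, Conj 2.5.1 p.32 l.8–14] -/
theorem vojtaHeightInequality_shiftHt_iff {f : 𝔛.Pt → ℝ} {M : ℝ} (hf : ∀ P, |f P| ≤ M) :
    (shiftHt 𝔛 f).VojtaHeightInequality ↔ 𝔛.VojtaHeightInequality :=
  forall₄_congr fun d _ ε _ => vojtaInequality_shiftHt_iff 𝔛 hf d ε

/-- **The ineffective shadow (R1) is invariant under bounded shifts of `ht`.** [folklore] -/
theorem ratPointsHtBounded_shiftHt_iff {f : 𝔛.Pt → ℝ} {M : ℝ} (hf : ∀ P, |f P| ≤ M) :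
    RatPointsHtBounded (shiftHt 𝔛 f) ↔ RatPointsHtBounded 𝔛 := by
  simp only [RatPointsHtBounded, ratPoints_shiftHt, shiftHt_ht]
  constructor
  · rintro ⟨B, hB⟩
    refine ⟨B + M, fun P hP => ?_⟩
    have h1 := hB P hP
    have h2 := (abs_le.mp (hf P)).1
    linarith
  · rintro ⟨B, hB⟩
    refine ⟨B + M, fun P hP => ?_⟩
    have h1 := hB P hP
    have h2 := (abs_le.mp (hf P)).2
    linarith

/-- **… but an EXPLICIT bound is not**: at any `L`-rational point `P₀`, the constant shift `c = B + 1 − ht(P₀)` (a bounded function)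
breaks the bound `B`. [folklore] -/
theorem not_ratPointsHtLe_shiftHt_const {P₀ : 𝔛.Pt} (hP₀ : P₀ ∈ ratPoints 𝔛) (B : ℝ) :
    ¬ RatPointsHtLe (shiftHt 𝔛 fun _ => B + 1 - 𝔛.ht P₀) B := by
  intro h
  have h1 := h P₀ hP₀
  simp only [shiftHt_ht] at h1
  linarith

/-- **(N2) in kernel form, packaged.** For a curve datum with at least one `L`-rational point and ANY candidate bound `B` there is a
renormalisation of the height by a CONSTANT (so within the O(1)-class in which `ht_{ω_X(D)}` is defined) under which the typed Thm 2.10.1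
and the ineffective shadow (R1) keep their truth values while the explicit bound `B` FAILS. Hence no statement invariant under the
height's O(1)-ambiguity — in particular `ATS4.MainTheorem` as typed — can single out an explicit bound: an effective (3) presupposes
a NORMALISED height on `X(L)`, which the carrier does not fix (memo §3 (N2)). Bookkeeping about OUR typing; no claim about print's
argument, which routes (3) through effective abc [Elkies 1991] (Rmk 2.10.2). [cite: Joshi2024ATS4, Rmk 2.10.2 p.34 l.22–23] -/
theorem explicitBound_not_invariant_under_bounded_shift {P₀ : 𝔛.Pt} (hP₀ : P₀ ∈ ratPoints 𝔛) (B : ℝ) :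
    ∃ c : ℝ, ((shiftHt 𝔛 fun _ => c).VojtaHeightInequality ↔ 𝔛.VojtaHeightInequality) ∧
      (RatPointsHtBounded (shiftHt 𝔛 fun _ => c) ↔ RatPointsHtBounded 𝔛) ∧
      ¬ RatPointsHtLe (shiftHt 𝔛 fun _ => c) B :=
  ⟨B + 1 - 𝔛.ht P₀, vojtaHeightInequality_shiftHt_iff 𝔛 (M := |B + 1 - 𝔛.ht P₀|) fun _ => le_rfl,
    ratPointsHtBounded_shiftHt_iff 𝔛 (M := |B + 1 - 𝔛.ht P₀|) fun _ => le_rfl,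
    not_ratPointsHtLe_shiftHt_const 𝔛 hP₀ B⟩

/-! ## §5 Non-vacuity at the one GENUINE instance in the tree: the tripod `(ℙ¹_ℚ, {0, 1, ∞})`

For the tripod (`CurveHeightDatum.tripod`, E-t24: points `GenEll.NFPoint`, `U = GenEll.UP`, `ht = NFPoint.ht`) the `L`-rational points are the
`λ ∈ ℚ ∖ {0, 1}` and `ht(λ = n) = log n`: the ineffective shadow (R1) is FALSE there, unconditionally. So (R1) is not a vacuous predicate, and
the side hypothesis «`log-diff + log-con ≲ 0` on the `L`-points» of §3 is LOAD-BEARING: for `D ≠ ∅` (here `log-con_D(n)` = log of the radical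
of `n(n−1)`, unbounded) the typed Vojta inequality — for the tripod literally the strong abc-conjecture (`ATS4.vojtaHeightInequality_tripod_iff`)
— does not and must not bound the heights of rational points; the Mordell reading is the `D = ∅` case of §3. 0 facts. -/

/-- The `ℚ`-points `λ = q`, `q ≠ 0, 1`, are `L`-rational points of the tripod's `U = U_P`. [folklore] -/
theorem ratPoint_mem_ratPoints_tripod {q : ℚ} (h0 : q ≠ 0) (h1 : q ≠ 1) :
    ratPoint q ∈ ratPoints CurveHeightDatum.tripod :=
  ⟨(ratPoint_mem_UPle_one h0 h1).1, degree_ratPoint q⟩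

/-- The tripod height of the `ℚ`-point `λ = n` (`n ≥ 1`) is `log n` (Mathlib `Rat.logHeight₁_natCast`, degree `[ℚ:ℚ] = 1`). [folklore] -/
theorem tripod_ht_ratPoint_natCast (n : ℕ) [NeZero n] :
    CurveHeightDatum.tripod.ht (ratPoint (n : ℚ)) = Real.log n := by
  show ((ratPoint (n : ℚ)).degree : ℝ)⁻¹ * Height.logHeight₁ (n : ℚ) = Real.log n
  rw [degree_ratPoint, Rat.logHeight₁_natCast]
  simp

/-- **(R1) is FALSE for the tripod**: the heights `log n` of the rational points `λ = n` are unbounded. Unconditional; shows the shadow is a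
genuine (non-vacuous) predicate and that §3's side hypothesis cannot be dropped. [folklore] -/
theorem not_ratPointsHtBounded_tripod : ¬ RatPointsHtBounded CurveHeightDatum.tripod := by
  rintro ⟨B, hB⟩
  obtain ⟨n, hn⟩ := exists_nat_gt (max (Real.exp B) 2)
  have hn2 : (2 : ℝ) < n := lt_of_le_of_lt (le_max_right _ _) hn
  have hnB : Real.exp B < n := lt_of_le_of_lt (le_max_left _ _) hn
  have hn0' : (n : ℕ) ≠ 0 := by
    rintro rfl
    norm_num at hn2
  haveI : NeZero n := ⟨hn0'⟩
  have hq0 : ((n : ℕ) : ℚ) ≠ 0 := by exact_mod_cast hn0'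
  have hq1 : ((n : ℕ) : ℚ) ≠ 1 := by
    intro h
    have : (n : ℝ) = 1 := by exact_mod_cast (show (n : ℕ) = 1 by exact_mod_cast h)
    linarith
  have hP := hB (ratPoint (n : ℚ)) (ratPoint_mem_ratPoints_tripod hq0 hq1)
  rw [tripod_ht_ratPoint_natCast] at hP
  have hlog : B < Real.log n := by
    rw [Real.lt_log_iff_exp_lt (by linarith)]
    exact hnB
  linarith

/-- **Hence, at the tripod, the typed Vojta inequality (= the strong abc-conjecture, `ATS4.vojtaHeightInequality_tripod_iff`) can only hold if
`log-diff + log-con` is UNBOUNDED above on the rational points** — the contrapositive of §3 with §5's non-vacuity: the `D = ∅` side hypothesis of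
the Mordell reading is exactly what fails for an affine hyperbolic curve. An implication between typed statements; nothing asserted.
[cite: Joshi2024ATS4, Conj 2.6.1 p.32 l.18–22] -/
theorem not_bdLe_logDiff_logCon_tripod_of_vojta (h : CurveHeightDatum.tripod.VojtaHeightInequality) :
    ¬ BDLe (ratPoints CurveHeightDatum.tripod)
        (fun P => CurveHeightDatum.tripod.logDiff P + CurveHeightDatum.tripod.logCon P) 0 :=
  fun hD => not_ratPointsHtBounded_tripod (ratPointsHtBounded_of_vojtaHeightInequality _ h hD)

end Summit.ABC.IUTFork.Repair.RcatJoshiEffMordell
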